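import Mathlib
import Summits.QuantumFields.BalabanUV.Beta.FP.FreeBiResolventKernel

/-!
# `BalabanUV.Beta.FP.FreeBiResolventRowDiffCore` — road «FP» (binder row D1), lane IR-5′, FILE B-b2 (core) of the `hAB` plan: the `ℓ¹` NORMS OF THE
# SECOND AND THIRD DIFFERENCES OF THE HEAT INTEGRAL `k(z) = ∫₀^∞ u e^{−u} Π_i q^Λ_{2n²u}(z_i) du` (the kernel of `(Δ+1)⁻¹(Δ+1)⁻¹`, FILE B-b1):
# `Σ_z|D_νD_μk| ≤ (1260·48^D)²(n²)⁻¹`, `Σ_z|D_νD_μD⁻_{μ′}k| ≤ (1260·48^D)³((2∕3)^{−1∕2})³Γ(½)(n⁻¹)³` — uniformly in `Λ` — plus the entry formulas of the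
# sandwiches `(S_ν−1)·∂·of(f(x−y))·∂ᴴ` (the letters themselves are `FreeBiResolventRowDiff`)

HONEST DEPENDENCY (page 1, mandatory): continuum YM on T⁴ ⇐ BetaPertH ∧ nine spine estimates (0/9 proved); BetaPertH ⇐ (D1) ∧ (D4) ∧
CAP+tail; G-an2-4 gates asym, D1 and NE2/3/4.  HONEST FRAMING (cell contract, verbatim): «discharging `BetaPertH` makes Bałaban's UV
stability UNCONDITIONAL — a real constructive-QFT result; it is NOT the continuum limit and NOT the Clay problem.»  THIS MODULE is [folklore] real
analysis (dominated interchange of a finite sum with a Laplace integral, `(1∨s)^{−1∕2} ≤ s^{−1∕2}`, `∫₀^∞u^{−1∕2}e^{−u}du = Γ(½)`) over FILE B-b1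
(`FreeBiResolventKernel.biResolvent_apply_eq_integral`: the entries of `F₁²` are `∫₀^∞ u e^{−u}Π_i q^Λ_{2n²u}((x−y)_i)du`) and FILE B-a (`TorusHeatSemigroup`:
`Σ_z|D_νD_μK_{2s}| ≤ (C(1∨s)^{−1∕2})²`, `Σ_z|D_νD_μD⁻_{μ′}K_{3s}| ≤ (C(1∨s)^{−1∕2})³`, `C = 1260·48^D`), with b05's typed `GradOp`∕`shiftM`∕`LapS`
(`B5Action121`, `B5Prop11Plancherel`).  It cites nothing as a hypothesis, mints no `Prop`, has no `def`, 0 sorry.  NOT hAB (the tower assembly with the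
(T0′) chain's letters is FILE C), NOT (T1′), NOT D1, NOT BetaPertH, NOT continuum, NOT Clay.

ABSOLUTE RULE (cell charter, verbatim): «No internally-minted statement may enter as a cited fact. Every hypothesis is either kernel-proved in this
package or a verbatim quotation of a PUBLISHED theorem with page reference. The manuscript(s) under audit are NOT citable for their own disputed
steps — they are the thing under adjudication; programme-internal (2001/route/tribunal) claims are never citable.»

CONTENT.  §1 entries of `(S_ν−1)·A`, `∂·B`, `B·∂ᴴ` on any torus (`shiftM_sub_one_mul_apply`, `GradOp_mul_apply`, `mul_GradOp_conjTranspose_apply`) and,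
for a translation-invariant kernel `of(x y ↦ f(x−y))`, the second ∕ third difference shapes of FILE B-a (`diff₂_entry`, `diff₃_entry`); §2 real-analysis
helpers (`rpow` bookkeeping, integrability of `u e^{−u}·(heat factor)`, `∫u^{−1∕2}e^{−u} = Γ(½)`); §3 **`sum_abs_diff₂_biKernel_le`** ∕ **`sum_abs_diff₃_biKernel_le`**
(the `ℓ¹` norms of the differenced heat integral, `C = 1260·48^D`: `≤ C²(n²)⁻¹`, `≤ C³((2∕3)^{−1∕2})³Γ(½)(n⁻¹)³` — FILE B-a's `diff₂`∕`diff₃` bounds at heat times `n²u`,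
`2n²u∕3` integrated against `u e^{−u}`, the `u^{−1∕2}` from `(1∨s)^{−1∕2} ≤ s^{−1∕2}` being exactly what turns `n²·n⁻³` into the letter's `1∕n`).
Unit `b2b-balaban-beta-d1-formalise-leaf-05` (gen 23), 2026-08-21; `LEAVES-FP.md` row «(T1′) SOCKET» (plan `HOME/…/leaf-05/g23/hAB-PLAN.md` v2).
-/

noncomputable section

open scoped BigOperators ComplexConjugate Matrix
open Finset MeasureTheory Set

namespace Summit.QuantumFields.BalabanUV.Beta.FP.FreeBiResolventRowDiffCore

open Literature.Probability.LatticeModels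
open Literature.MathematicalPhysics.QuantumFieldTheory.Balaban1983to89
open Literature.MathematicalPhysics.QuantumFieldTheory.Balaban1983to89.B5Prop11Plancherel (Tor fine unitVec shiftM)
open Literature.MathematicalPhysics.QuantumFieldTheory.Balaban1983to89.B5Action121 (LapS GradOp sdiff shiftS)
open Summit.QuantumFields.BalabanUV.Beta.FP.TorusHeatSemigroup (sum_abs_prodHeat_le sum_abs_diff₂_prodHeat_le sum_abs_diff₃_prodHeat_le)
open Summit.QuantumFields.BalabanUV.Beta.FP.FreeBiResolventKernel (biResolvent_apply_eq_integral)

/-! ## §1 Entries of the sandwiches -/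

section Entries

variable {d : ℕ} (N : Fin d → ℕ) [hN : ∀ μ, NeZero (N μ)]

/-- [folklore] entries of `(S_ν − 1)·A`: `((S_ν − 1)·A) i j = A (i.1 + e_ν, i.2) j − A i j`. -/
theorem shiftM_sub_one_mul_apply {κ : Type*} (ν : Fin d) (A : Matrix (Tor N × Fin d) κ ℂ) (i : Tor N × Fin d) (j : κ) :
    ((shiftM N ν - (1 : Matrix (Tor N × Fin d) (Tor N × Fin d) ℂ)) * A) i j = A (i.1 + unitVec N ν, i.2) j - A i j := by
  rw [Matrix.sub_mul, Matrix.one_mul, Matrix.sub_apply, Matrix.mul_apply, Finset.sum_eq_single (i.1 + unitVec N ν, i.2)]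
  · simp [shiftM]
  · intro k _ hk; simp [shiftM, hk]
  · intro h; exact absurd (Finset.mem_univ _) h

/-- [folklore] entries of `∂·B`: `(∂·B) (x,μ) j = c·(B (x + e_μ) j − B x j)` (`GradOp_mulVec`, `sdiff_mulVec` on the column `j`). -/
theorem GradOp_mul_apply {κ : Type*} (c : ℂ) (B : Matrix (Tor N) κ ℂ) (x : Tor N) (μ : Fin d) (j : κ) :
    (GradOp N c * B) (x, μ) j = c * (B (x + unitVec N μ) j - B x j) := by
  rw [show (GradOp N c * B) (x, μ) j = (GradOp N c *ᵥ (fun y => B y j)) (x, μ) from rfl, B5Action121.GradOp_mulVec,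
    B5Action121.sdiff_mulVec]

/-- [folklore] entries of `B·∂ᴴ`: `(B·∂ᴴ) r (y,μ′) = conj c·(B r (y + e_{μ′}) − B r y)`. -/
theorem mul_GradOp_conjTranspose_apply {κ : Type*} (c : ℂ) (B : Matrix κ (Tor N) ℂ) (r : κ) (y : Tor N) (μ' : Fin d) :
    (B * (GradOp N c)ᴴ) r (y, μ') = conj c * (B r (y + unitVec N μ') - B r y) := by
  have h1 : (B * (GradOp N c)ᴴ) r (y, μ') = conj ((GradOp N c *ᵥ (fun w => conj (B r w))) (y, μ')) := by
    rw [Matrix.mul_apply, Matrix.mulVec, dotProduct, map_sum]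
    refine Finset.sum_congr rfl fun w _ => ?_
    rw [Matrix.conjTranspose_apply, map_mul, Complex.conj_conj, Complex.star_def, mul_comm]
  rw [h1, B5Action121.GradOp_mulVec, B5Action121.sdiff_mulVec, map_mul, map_sub, Complex.conj_conj, Complex.conj_conj]

/-- [folklore] **THE SECOND-DIFFERENCE ENTRY** of `(S_ν−1)·∂·of(f(x−y))`: `= c·(f(z+e_ν+e_μ) − f(z+e_ν) − f(z+e_μ) + f z)`, `z = x − y`. -/
theorem diff₂_entry (c : ℂ) (f : Tor N → ℂ) (ν μ : Fin d) (x y : Tor N) :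
    ((shiftM N ν - (1 : Matrix (Tor N × Fin d) (Tor N × Fin d) ℂ)) * GradOp N c * Matrix.of (fun x y : Tor N => f (x - y))) (x, μ) y
      = c * (f (x - y + unitVec N ν + unitVec N μ) - f (x - y + unitVec N ν) - f (x - y + unitVec N μ) + f (x - y)) := by
  rw [Matrix.mul_assoc, shiftM_sub_one_mul_apply, GradOp_mul_apply, GradOp_mul_apply]
  simp only [Matrix.of_apply]
  rw [show x + unitVec N ν + unitVec N μ - y = x - y + unitVec N ν + unitVec N μ by abel,
    show x + unitVec N ν - y = x - y + unitVec N ν by abel, show x + unitVec N μ - y = x - y + unitVec N μ by abel]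
  ring

/-- [folklore] **THE THIRD-DIFFERENCE ENTRY** of `(S_ν−1)·∂·of(f(x−y))·∂ᴴ` (FILE B-a's `diff₃` shape, `z = x − y`, `e′ = e_{μ′}`):
`= conj c·c·([f(z−e′+e_ν+e_μ) − f(z−e′+e_ν) − f(z−e′+e_μ) + f(z−e′)] − [f(z+e_ν+e_μ) − f(z+e_ν) − f(z+e_μ) + f z])`. -/
theorem diff₃_entry (c : ℂ) (f : Tor N → ℂ) (ν μ μ' : Fin d) (x y : Tor N) :
    ((shiftM N ν - (1 : Matrix (Tor N × Fin d) (Tor N × Fin d) ℂ)) * GradOp N c * Matrix.of (fun x y : Tor N => f (x - y)) * (GradOp N c)ᴴ) (x, μ) (y, μ')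
      = conj c * c * ((f (x - y - unitVec N μ' + unitVec N ν + unitVec N μ) - f (x - y - unitVec N μ' + unitVec N ν)
          - f (x - y - unitVec N μ' + unitVec N μ) + f (x - y - unitVec N μ'))
        - (f (x - y + unitVec N ν + unitVec N μ) - f (x - y + unitVec N ν) - f (x - y + unitVec N μ) + f (x - y))) := by
  rw [mul_GradOp_conjTranspose_apply, diff₂_entry, diff₂_entry]
  rw [show x - (y + unitVec N μ') = x - y - unitVec N μ' by abel]
  ring

end Entries

/-! ## §2 Real-analysis helpers -/

section Helpers

/-- [folklore] `(1 ∨ s)^{−1∕2} ≤ s^{−1∕2}` for `s > 0`. -/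
theorem max_rpow_le {s : ℝ} (hs : 0 < s) : (max 1 s) ^ (-(1 / 2 : ℝ)) ≤ s ^ (-(1 / 2 : ℝ)) :=
  Real.rpow_le_rpow_of_nonpos hs (le_max_right _ _) (by norm_num)

/-- [folklore] `((1 ∨ s)^{−1∕2})² ≤ s⁻¹` for `s > 0`. -/
theorem max_rpow_sq_le {s : ℝ} (hs : 0 < s) : ((max 1 s) ^ (-(1 / 2 : ℝ))) ^ 2 ≤ s⁻¹ := by
  have h1 : ((max 1 s) ^ (-(1 / 2 : ℝ))) ^ 2 = (max 1 s)⁻¹ := by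
    rw [← Real.rpow_natCast, ← Real.rpow_mul (by positivity)]
    norm_num
    exact Real.rpow_neg_one _
  rw [h1]
  exact inv_anti₀ hs (le_max_right _ _)

/-- [folklore] `u·(u^{−1∕2})³ = u^{−1∕2}` for `u > 0`. -/
theorem mul_rpow_neg_half_cube {u : ℝ} (hu : 0 < u) : u * (u ^ (-(1 / 2 : ℝ))) ^ 3 = u ^ (-(1 / 2 : ℝ)) := by
  have h2 : u ^ (-(1 / 2 : ℝ)) * u ^ (-(1 / 2 : ℝ)) = u⁻¹ := by
    rw [← Real.rpow_add hu]; norm_num; exact Real.rpow_neg_one u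
  calc u * (u ^ (-(1 / 2 : ℝ))) ^ 3 = u * (u ^ (-(1 / 2 : ℝ)) * u ^ (-(1 / 2 : ℝ))) * u ^ (-(1 / 2 : ℝ)) := by ring
    _ = u ^ (-(1 / 2 : ℝ)) := by rw [h2, mul_inv_cancel₀ hu.ne', one_mul]

/-- [folklore] `(a·u)^{−1∕2} = a^{−1∕2}·u^{−1∕2}` for `a, u ≥ 0`. -/
theorem mul_rpow_neg_half {a u : ℝ} (ha : 0 ≤ a) (hu : 0 ≤ u) : (a * u) ^ (-(1 / 2 : ℝ)) = a ^ (-(1 / 2 : ℝ)) * u ^ (-(1 / 2 : ℝ)) :=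
  Real.mul_rpow ha hu

/-- [folklore] `∫₀^∞ u^{−1∕2}e^{−u} du = Γ(½)`. -/
theorem integral_rpow_neg_half_mul_exp_neg : ∫ u in Ioi (0 : ℝ), u ^ (-(1 / 2 : ℝ)) * Real.exp (-u) = Real.Gamma (1 / 2) := by
  rw [Real.Gamma_eq_integral (by norm_num : (0 : ℝ) < 1 / 2)]
  refine setIntegral_congr_fun measurableSet_Ioi fun u _ => ?_
  rw [show (1 / 2 : ℝ) - 1 = -(1 / 2) by norm_num, mul_comm]

/-- [folklore] `u ↦ u^{−1∕2}e^{−u}` is integrable on `(0,∞)`. -/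
theorem integrableOn_rpow_neg_half_mul_exp_neg : IntegrableOn (fun u : ℝ => u ^ (-(1 / 2 : ℝ)) * Real.exp (-u)) (Ioi 0) := by
  have h := Real.GammaIntegral_convergent (s := 1 / 2) (by norm_num)
  refine h.congr_fun (fun u _ => ?_) measurableSet_Ioi
  rw [show (1 / 2 : ℝ) - 1 = -(1 / 2) by norm_num, mul_comm]

/-- [folklore] `u ↦ u·e^{−u}` is integrable on `(0,∞)`. -/
theorem integrableOn_mul_exp_neg : IntegrableOn (fun u : ℝ => u * Real.exp (-u)) (Ioi 0) := by
  have h0 : IntegrableOn (fun u : ℝ => u ^ (1 : ℝ) * Real.exp (-1 * u ^ (1 : ℝ))) (Ioi 0) :=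
    integrableOn_rpow_mul_exp_neg_mul_rpow (by norm_num) le_rfl one_pos
  refine h0.congr_fun (fun u _ => ?_) measurableSet_Ioi
  simp only [Real.rpow_one, neg_mul, one_mul]

variable {D Λ : ℕ} [NeZero Λ]

/-- [folklore] `|Π_i q^Λ_t(z_i)| ≤ 48^D` for `t > 0` (one term of FILE B-a's `ℓ¹` bound). -/
theorem abs_prodHeat_le {t : ℝ} (ht : 0 < t) (z : TorusSite D Λ) : |∏ i, torusHeatKernel t (z i)| ≤ (48 : ℝ) ^ D :=
  (Finset.single_le_sum (fun w _ => abs_nonneg (∏ i, torusHeatKernel t (w i))) (Finset.mem_univ z)).trans (sum_abs_prodHeat_le ht)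

/-- [folklore] the Laplace integrand `u ↦ u e^{−u}·Π_i q_{2n²u}(z_i)` is integrable on `(0, ∞)` (dominated by `48^D·u e^{−u}`). -/
theorem integrableOn_heatIntegrand (n : ℕ) [NeZero n] (z : TorusSite D Λ) :
    IntegrableOn (fun u : ℝ => u * Real.exp (-u) * ∏ i, torusHeatKernel (2 * (n : ℝ) ^ 2 * u) (z i)) (Ioi 0) := by
  have hn : (0 : ℝ) < (n : ℝ) ^ 2 := by have := NeZero.pos n; positivity
  have hmaj : IntegrableOn (fun u : ℝ => (48 : ℝ) ^ D * (u * Real.exp (-u))) (Ioi 0) := integrableOn_mul_exp_neg.const_mul _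
  refine Integrable.mono' hmaj ?_ ?_
  · refine (Continuous.mul (by fun_prop) ?_).aestronglyMeasurable
    exact continuous_finsetProd _ fun i _ => (continuous_torusHeatKernel (z i)).comp (by fun_prop)
  · refine (ae_restrict_iff' measurableSet_Ioi).2 (Filter.Eventually.of_forall fun u (hu : 0 < u) => ?_)
    rw [norm_mul, Real.norm_eq_abs, Real.norm_eq_abs, abs_of_pos (mul_pos hu (Real.exp_pos _)), mul_comm]
    exact mul_le_mul_of_nonneg_right (abs_prodHeat_le (by positivity) z) (mul_pos hu (Real.exp_pos _)).le

end Helpers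

/-! ## §3 The differenced heat integral `k(z) = ∫₀^∞ u e^{−u} Π_i q_{2n²u}(z_i) du` in `ℓ¹` -/

section Core

variable {D Λ : ℕ} [NeZero Λ] (n : ℕ) [NeZero n]

/-- [folklore] `∫₀^∞ e^{−u} du = 1`. -/
theorem integral_exp_neg_Ioi : ∫ u in Ioi (0 : ℝ), Real.exp (-u) = 1 := by
  have h := integral_exp_neg_Ioi_zero
  simpa using h

/-- [our bookkeeping] **SECOND DIFFERENCES OF THE HEAT INTEGRAL IN `ℓ¹`**: with `k(z) = ∫₀^∞ u e^{−u}Π_i q^Λ_{2n²u}(z_i)du`,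
`Σ_z |k(z+e_ν+e_μ) − k(z+e_ν) − k(z+e_μ) + k(z)| ≤ (1260·48^D)²·(n²)⁻¹` (FILE B-a `sum_abs_diff₂_prodHeat_le` at `s = n²u`, `((1∨s)^{−1∕2})² ≤ s⁻¹`,
`∫₀^∞ u e^{−u}(n²u)⁻¹du = (n²)⁻¹`). -/
theorem sum_abs_diff₂_biKernel_le (ν μ : Fin D) :
    ∑ z : TorusSite D Λ,
      |(∫ u in Ioi (0 : ℝ), u * Real.exp (-u) * ∏ i, torusHeatKernel (2 * (n : ℝ) ^ 2 * u) ((z + Pi.single ν 1 + Pi.single μ 1 : TorusSite D Λ) i))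
        - (∫ u in Ioi (0 : ℝ), u * Real.exp (-u) * ∏ i, torusHeatKernel (2 * (n : ℝ) ^ 2 * u) ((z + Pi.single ν 1 : TorusSite D Λ) i))
        - (∫ u in Ioi (0 : ℝ), u * Real.exp (-u) * ∏ i, torusHeatKernel (2 * (n : ℝ) ^ 2 * u) ((z + Pi.single μ 1 : TorusSite D Λ) i))
        + (∫ u in Ioi (0 : ℝ), u * Real.exp (-u) * ∏ i, torusHeatKernel (2 * (n : ℝ) ^ 2 * u) (z i))|
      ≤ (1260 * (48 : ℝ) ^ D) ^ 2 * ((n : ℝ) ^ 2)⁻¹ := by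
  have hn : (0 : ℝ) < (n : ℝ) ^ 2 := by have := NeZero.pos n; positivity
  -- abbreviations
  set P : ℝ → TorusSite D Λ → ℝ := fun u w => ∏ i, torusHeatKernel (2 * (n : ℝ) ^ 2 * u) (w i) with hP
  set F : TorusSite D Λ → ℝ → ℝ := fun z u => u * Real.exp (-u) *
    (P u (z + Pi.single ν 1 + Pi.single μ 1) - P u (z + Pi.single ν 1) - P u (z + Pi.single μ 1) + P u z) with hF
  have hI : ∀ w : TorusSite D Λ, IntegrableOn (fun u : ℝ => u * Real.exp (-u) * P u w) (Ioi 0) := fun w => integrableOn_heatIntegrand n w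
  -- each difference of integrals is the integral of the difference
  have hcomb : ∀ z : TorusSite D Λ,
      (∫ u in Ioi (0 : ℝ), u * Real.exp (-u) * P u (z + Pi.single ν 1 + Pi.single μ 1))
        - (∫ u in Ioi (0 : ℝ), u * Real.exp (-u) * P u (z + Pi.single ν 1))
        - (∫ u in Ioi (0 : ℝ), u * Real.exp (-u) * P u (z + Pi.single μ 1))
        + (∫ u in Ioi (0 : ℝ), u * Real.exp (-u) * P u z) = ∫ u in Ioi (0 : ℝ), F z u := by
    intro z
    have e : (∫ u in Ioi (0 : ℝ), F z u) = ∫ u in Ioi (0 : ℝ), ((u * Real.exp (-u) * P u (z + Pi.single ν 1 + Pi.single μ 1)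
        - u * Real.exp (-u) * P u (z + Pi.single ν 1)) - u * Real.exp (-u) * P u (z + Pi.single μ 1)) + u * Real.exp (-u) * P u z :=
      integral_congr_ae (Filter.Eventually.of_forall fun u => by simp only [hF]; ring)
    have h12 : IntegrableOn (fun u : ℝ => u * Real.exp (-u) * P u (z + Pi.single ν 1 + Pi.single μ 1)
        - u * Real.exp (-u) * P u (z + Pi.single ν 1)) (Ioi 0) := (hI _).sub (hI _)
    have h123 : IntegrableOn (fun u : ℝ => (u * Real.exp (-u) * P u (z + Pi.single ν 1 + Pi.single μ 1)
        - u * Real.exp (-u) * P u (z + Pi.single ν 1)) - u * Real.exp (-u) * P u (z + Pi.single μ 1)) (Ioi 0) := h12.sub (hI _)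
    rw [e, integral_add h123 (hI z), integral_sub h12 (hI _), integral_sub (hI _) (hI _)]
  have hFint : ∀ z, IntegrableOn (F z) (Ioi 0) := fun z => by
    have h := (((hI (z + Pi.single ν 1 + Pi.single μ 1)).sub (hI (z + Pi.single ν 1))).sub (hI (z + Pi.single μ 1))).add (hI z)
    refine h.congr_fun (fun u _ => ?_) measurableSet_Ioi
    simp only [hF, Pi.sub_apply, Pi.add_apply]; ring
  -- pointwise in `u`: FILE B-a's second-difference bound at heat time `s + s`, `s = n²u`
  have hpt : ∀ u : ℝ, 0 < u → ∑ z : TorusSite D Λ, |F z u| ≤ (1260 * (48 : ℝ) ^ D) ^ 2 * ((n : ℝ) ^ 2)⁻¹ * Real.exp (-u) := by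
    intro u hu
    have hs : 0 < (n : ℝ) ^ 2 * u := mul_pos hn hu
    have h2 := sum_abs_diff₂_prodHeat_le (Λ := Λ) (D := D) hs ν μ
    have ht : (n : ℝ) ^ 2 * u + (n : ℝ) ^ 2 * u = 2 * (n : ℝ) ^ 2 * u := by ring
    rw [ht] at h2
    have hfac : ∀ z : TorusSite D Λ, |F z u| = u * Real.exp (-u) *
        |P u (z + Pi.single ν 1 + Pi.single μ 1) - P u (z + Pi.single ν 1) - P u (z + Pi.single μ 1) + P u z| := by
      intro z
      rw [hF]; simp only
      rw [abs_mul, abs_of_pos (mul_pos hu (Real.exp_pos _))]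
    simp_rw [hfac]
    rw [← Finset.mul_sum]
    calc u * Real.exp (-u) * ∑ z : TorusSite D Λ, |P u (z + Pi.single ν 1 + Pi.single μ 1) - P u (z + Pi.single ν 1) - P u (z + Pi.single μ 1) + P u z|
        ≤ u * Real.exp (-u) * (1260 * (48 : ℝ) ^ D * (max 1 ((n : ℝ) ^ 2 * u)) ^ (-(1 / 2 : ℝ))) ^ 2 :=
          mul_le_mul_of_nonneg_left h2 (mul_pos hu (Real.exp_pos _)).le
      _ = u * Real.exp (-u) * ((1260 * (48 : ℝ) ^ D) ^ 2 * ((max 1 ((n : ℝ) ^ 2 * u)) ^ (-(1 / 2 : ℝ))) ^ 2) := by ring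
      _ ≤ u * Real.exp (-u) * ((1260 * (48 : ℝ) ^ D) ^ 2 * ((n : ℝ) ^ 2 * u)⁻¹) :=
          mul_le_mul_of_nonneg_left (mul_le_mul_of_nonneg_left (max_rpow_sq_le hs) (by positivity)) (mul_pos hu (Real.exp_pos _)).le
      _ = (1260 * (48 : ℝ) ^ D) ^ 2 * ((n : ℝ) ^ 2)⁻¹ * Real.exp (-u) := by field_simp
  -- assemble
  have hmaj : IntegrableOn (fun u : ℝ => (1260 * (48 : ℝ) ^ D) ^ 2 * ((n : ℝ) ^ 2)⁻¹ * Real.exp (-u)) (Ioi 0) :=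
    ((exp_neg_integrableOn_Ioi 0 one_pos).congr_fun (fun u _ => by simp) measurableSet_Ioi).const_mul _
  calc ∑ z : TorusSite D Λ, |(∫ u in Ioi (0 : ℝ), u * Real.exp (-u) * P u (z + Pi.single ν 1 + Pi.single μ 1))
          - (∫ u in Ioi (0 : ℝ), u * Real.exp (-u) * P u (z + Pi.single ν 1))
          - (∫ u in Ioi (0 : ℝ), u * Real.exp (-u) * P u (z + Pi.single μ 1))
          + (∫ u in Ioi (0 : ℝ), u * Real.exp (-u) * P u z)|
      = ∑ z : TorusSite D Λ, |∫ u in Ioi (0 : ℝ), F z u| := Finset.sum_congr rfl fun z _ => by rw [hcomb z]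
    _ ≤ ∑ z : TorusSite D Λ, ∫ u in Ioi (0 : ℝ), |F z u| := Finset.sum_le_sum fun z _ => abs_integral_le_integral_abs
    _ = ∫ u in Ioi (0 : ℝ), ∑ z : TorusSite D Λ, |F z u| := (integral_finsetSum _ fun z _ => (hFint z).abs).symm
    _ ≤ ∫ u in Ioi (0 : ℝ), (1260 * (48 : ℝ) ^ D) ^ 2 * ((n : ℝ) ^ 2)⁻¹ * Real.exp (-u) :=
        setIntegral_mono_on (integrable_finsetSum _ fun z _ => (hFint z).abs) hmaj measurableSet_Ioi fun u hu => hpt u hu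
    _ = (1260 * (48 : ℝ) ^ D) ^ 2 * ((n : ℝ) ^ 2)⁻¹ := by rw [integral_const_mul, integral_exp_neg_Ioi, mul_one]

/-- [our bookkeeping] **THIRD DIFFERENCES OF THE HEAT INTEGRAL IN `ℓ¹`** (two forward, one backward — FILE B-a's `diff₃` shape):
`Σ_z |D_νD_μD⁻_{μ′}k(z)| ≤ (1260·48^D)³·((2∕3)^{−1∕2})³·Γ(½)·(n⁻¹)³` (FILE B-a `sum_abs_diff₃_prodHeat_le` at `s = 2n²u∕3`, `(1∨s)^{−1∕2} ≤ s^{−1∕2} =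
(2∕3)^{−1∕2}·n⁻¹·u^{−1∕2}`, `u·(u^{−1∕2})³ = u^{−1∕2}`, `∫₀^∞u^{−1∕2}e^{−u} = Γ(½)`). -/
theorem sum_abs_diff₃_biKernel_le (ν μ μ' : Fin D) :
    ∑ z : TorusSite D Λ,
      |((∫ u in Ioi (0 : ℝ), u * Real.exp (-u) * ∏ i, torusHeatKernel (2 * (n : ℝ) ^ 2 * u) ((z - Pi.single μ' 1 + Pi.single ν 1 + Pi.single μ 1 : TorusSite D Λ) i))
        - (∫ u in Ioi (0 : ℝ), u * Real.exp (-u) * ∏ i, torusHeatKernel (2 * (n : ℝ) ^ 2 * u) ((z - Pi.single μ' 1 + Pi.single ν 1 : TorusSite D Λ) i))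
        - (∫ u in Ioi (0 : ℝ), u * Real.exp (-u) * ∏ i, torusHeatKernel (2 * (n : ℝ) ^ 2 * u) ((z - Pi.single μ' 1 + Pi.single μ 1 : TorusSite D Λ) i))
        + (∫ u in Ioi (0 : ℝ), u * Real.exp (-u) * ∏ i, torusHeatKernel (2 * (n : ℝ) ^ 2 * u) ((z - Pi.single μ' 1 : TorusSite D Λ) i)))
      - ((∫ u in Ioi (0 : ℝ), u * Real.exp (-u) * ∏ i, torusHeatKernel (2 * (n : ℝ) ^ 2 * u) ((z + Pi.single ν 1 + Pi.single μ 1 : TorusSite D Λ) i))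
        - (∫ u in Ioi (0 : ℝ), u * Real.exp (-u) * ∏ i, torusHeatKernel (2 * (n : ℝ) ^ 2 * u) ((z + Pi.single ν 1 : TorusSite D Λ) i))
        - (∫ u in Ioi (0 : ℝ), u * Real.exp (-u) * ∏ i, torusHeatKernel (2 * (n : ℝ) ^ 2 * u) ((z + Pi.single μ 1 : TorusSite D Λ) i))
        + (∫ u in Ioi (0 : ℝ), u * Real.exp (-u) * ∏ i, torusHeatKernel (2 * (n : ℝ) ^ 2 * u) (z i)))|
      ≤ (1260 * (48 : ℝ) ^ D) ^ 3 * ((2 / 3 : ℝ) ^ (-(1 / 2 : ℝ))) ^ 3 * Real.Gamma (1 / 2) * ((n : ℝ)⁻¹) ^ 3 := by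
  have hn0 : (0 : ℝ) < (n : ℝ) := by exact_mod_cast NeZero.pos n
  have hn : (0 : ℝ) < (n : ℝ) ^ 2 := by positivity
  -- abbreviations
  set P : ℝ → TorusSite D Λ → ℝ := fun u w => ∏ i, torusHeatKernel (2 * (n : ℝ) ^ 2 * u) (w i) with hP
  set G : ℝ → TorusSite D Λ → ℝ := fun u z =>
    (P u (z - Pi.single μ' 1 + Pi.single ν 1 + Pi.single μ 1) - P u (z - Pi.single μ' 1 + Pi.single ν 1)
      - P u (z - Pi.single μ' 1 + Pi.single μ 1) + P u (z - Pi.single μ' 1))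
    - (P u (z + Pi.single ν 1 + Pi.single μ 1) - P u (z + Pi.single ν 1) - P u (z + Pi.single μ 1) + P u z) with hG
  set F : TorusSite D Λ → ℝ → ℝ := fun z u => u * Real.exp (-u) * G u z with hF
  set K : ℝ := (1260 * (48 : ℝ) ^ D) ^ 3 * ((2 / 3 : ℝ) ^ (-(1 / 2 : ℝ))) ^ 3 * ((n : ℝ)⁻¹) ^ 3 with hK
  have hI : ∀ w : TorusSite D Λ, IntegrableOn (fun u : ℝ => u * Real.exp (-u) * P u w) (Ioi 0) := fun w => integrableOn_heatIntegrand n w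
  -- the combination of eight integrals is the integral of the combination
  have hcomb : ∀ z : TorusSite D Λ,
      ((∫ u in Ioi (0 : ℝ), u * Real.exp (-u) * P u (z - Pi.single μ' 1 + Pi.single ν 1 + Pi.single μ 1))
        - (∫ u in Ioi (0 : ℝ), u * Real.exp (-u) * P u (z - Pi.single μ' 1 + Pi.single ν 1))
        - (∫ u in Ioi (0 : ℝ), u * Real.exp (-u) * P u (z - Pi.single μ' 1 + Pi.single μ 1))
        + (∫ u in Ioi (0 : ℝ), u * Real.exp (-u) * P u (z - Pi.single μ' 1)))
      - ((∫ u in Ioi (0 : ℝ), u * Real.exp (-u) * P u (z + Pi.single ν 1 + Pi.single μ 1))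
        - (∫ u in Ioi (0 : ℝ), u * Real.exp (-u) * P u (z + Pi.single ν 1))
        - (∫ u in Ioi (0 : ℝ), u * Real.exp (-u) * P u (z + Pi.single μ 1))
        + (∫ u in Ioi (0 : ℝ), u * Real.exp (-u) * P u z)) = ∫ u in Ioi (0 : ℝ), F z u := by
    intro z
    -- first bracket
    have h12 : IntegrableOn (fun u : ℝ => u * Real.exp (-u) * P u (z - Pi.single μ' 1 + Pi.single ν 1 + Pi.single μ 1)
        - u * Real.exp (-u) * P u (z - Pi.single μ' 1 + Pi.single ν 1)) (Ioi 0) := (hI _).sub (hI _)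
    have h123 : IntegrableOn (fun u : ℝ => (u * Real.exp (-u) * P u (z - Pi.single μ' 1 + Pi.single ν 1 + Pi.single μ 1)
        - u * Real.exp (-u) * P u (z - Pi.single μ' 1 + Pi.single ν 1)) - u * Real.exp (-u) * P u (z - Pi.single μ' 1 + Pi.single μ 1)) (Ioi 0) :=
      h12.sub (hI _)
    have h1234 : IntegrableOn (fun u : ℝ => ((u * Real.exp (-u) * P u (z - Pi.single μ' 1 + Pi.single ν 1 + Pi.single μ 1)
        - u * Real.exp (-u) * P u (z - Pi.single μ' 1 + Pi.single ν 1)) - u * Real.exp (-u) * P u (z - Pi.single μ' 1 + Pi.single μ 1))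
        + u * Real.exp (-u) * P u (z - Pi.single μ' 1)) (Ioi 0) := h123.add (hI _)
    -- second bracket
    have g12 : IntegrableOn (fun u : ℝ => u * Real.exp (-u) * P u (z + Pi.single ν 1 + Pi.single μ 1)
        - u * Real.exp (-u) * P u (z + Pi.single ν 1)) (Ioi 0) := (hI _).sub (hI _)
    have g123 : IntegrableOn (fun u : ℝ => (u * Real.exp (-u) * P u (z + Pi.single ν 1 + Pi.single μ 1)
        - u * Real.exp (-u) * P u (z + Pi.single ν 1)) - u * Real.exp (-u) * P u (z + Pi.single μ 1)) (Ioi 0) := g12.sub (hI _)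
    have g1234 : IntegrableOn (fun u : ℝ => ((u * Real.exp (-u) * P u (z + Pi.single ν 1 + Pi.single μ 1)
        - u * Real.exp (-u) * P u (z + Pi.single ν 1)) - u * Real.exp (-u) * P u (z + Pi.single μ 1))
        + u * Real.exp (-u) * P u z) (Ioi 0) := g123.add (hI _)
    have e : (∫ u in Ioi (0 : ℝ), F z u) = ∫ u in Ioi (0 : ℝ),
        (((u * Real.exp (-u) * P u (z - Pi.single μ' 1 + Pi.single ν 1 + Pi.single μ 1)
          - u * Real.exp (-u) * P u (z - Pi.single μ' 1 + Pi.single ν 1)) - u * Real.exp (-u) * P u (z - Pi.single μ' 1 + Pi.single μ 1))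
          + u * Real.exp (-u) * P u (z - Pi.single μ' 1))
        - (((u * Real.exp (-u) * P u (z + Pi.single ν 1 + Pi.single μ 1)
          - u * Real.exp (-u) * P u (z + Pi.single ν 1)) - u * Real.exp (-u) * P u (z + Pi.single μ 1))
          + u * Real.exp (-u) * P u z) :=
      integral_congr_ae (Filter.Eventually.of_forall fun u => by simp only [hF, hG]; ring)
    rw [e, integral_sub h1234 g1234, integral_add h123 (hI _), integral_sub h12 (hI _), integral_sub (hI _) (hI _),
      integral_add g123 (hI _), integral_sub g12 (hI _), integral_sub (hI _) (hI _)]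
  have hFint : ∀ z, IntegrableOn (F z) (Ioi 0) := fun z => by
    have h := ((((hI (z - Pi.single μ' 1 + Pi.single ν 1 + Pi.single μ 1)).sub (hI (z - Pi.single μ' 1 + Pi.single ν 1))).sub
      (hI (z - Pi.single μ' 1 + Pi.single μ 1))).add (hI (z - Pi.single μ' 1))).sub
      ((((hI (z + Pi.single ν 1 + Pi.single μ 1)).sub (hI (z + Pi.single ν 1))).sub (hI (z + Pi.single μ 1))).add (hI z))
    refine h.congr_fun (fun u _ => ?_) measurableSet_Ioi
    simp only [hF, hG, Pi.sub_apply, Pi.add_apply]; ring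
  -- pointwise in `u`: FILE B-a's third-difference bound at heat time `s + s + s`, `s = 2n²u∕3`
  have hpt : ∀ u : ℝ, 0 < u → ∑ z : TorusSite D Λ, |F z u| ≤ K * (u ^ (-(1 / 2 : ℝ)) * Real.exp (-u)) := by
    intro u hu
    have hs : 0 < 2 * (n : ℝ) ^ 2 * u / 3 := by positivity
    have h3 := sum_abs_diff₃_prodHeat_le (Λ := Λ) (D := D) hs ν μ μ'
    have ht : 2 * (n : ℝ) ^ 2 * u / 3 + 2 * (n : ℝ) ^ 2 * u / 3 + 2 * (n : ℝ) ^ 2 * u / 3 = 2 * (n : ℝ) ^ 2 * u := by ring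
    rw [ht] at h3
    have hfac : ∀ z : TorusSite D Λ, |F z u| = u * Real.exp (-u) * |G u z| := by
      intro z
      rw [hF]; simp only
      rw [abs_mul, abs_of_pos (mul_pos hu (Real.exp_pos _))]
    simp_rw [hfac]
    rw [← Finset.mul_sum]
    -- the sum is B-a's
    have hsum : ∑ z : TorusSite D Λ, |G u z| ≤ (1260 * (48 : ℝ) ^ D * (max 1 (2 * (n : ℝ) ^ 2 * u / 3)) ^ (-(1 / 2 : ℝ))) ^ 3 := by
      simpa only [hG, hP] using h3
    -- (1∨s)^{−1∕2} ≤ s^{−1∕2} = (2∕3)^{−1∕2}·n⁻¹·u^{−1∕2}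
    have hmax : (max 1 (2 * (n : ℝ) ^ 2 * u / 3)) ^ (-(1 / 2 : ℝ)) ≤ ((2 / 3 : ℝ) ^ (-(1 / 2 : ℝ))) * (n : ℝ)⁻¹ * u ^ (-(1 / 2 : ℝ)) := by
      refine (max_rpow_le hs).trans (le_of_eq ?_)
      -- `(n²)^{−1∕2} = n⁻¹` (the tree's `Literature.Analysis.FluidPDE.sq_rpow_neg_half_eq_inv`, inlined to keep the imports light)
      have hsq : ((n : ℝ) ^ 2) ^ (-(1 / 2 : ℝ)) = (n : ℝ)⁻¹ := by
        rw [show ((n : ℝ) ^ 2 : ℝ) = (n : ℝ) ^ (2 : ℝ) by norm_cast, ← Real.rpow_mul hn0.le]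
        norm_num
        exact Real.rpow_neg_one _
      rw [show 2 * (n : ℝ) ^ 2 * u / 3 = (2 / 3 * (n : ℝ) ^ 2) * u by ring, mul_rpow_neg_half (by positivity) hu.le,
        mul_rpow_neg_half (by norm_num) hn.le, hsq]
    have hcube : (1260 * (48 : ℝ) ^ D * (max 1 (2 * (n : ℝ) ^ 2 * u / 3)) ^ (-(1 / 2 : ℝ))) ^ 3
        ≤ (1260 * (48 : ℝ) ^ D * (((2 / 3 : ℝ) ^ (-(1 / 2 : ℝ))) * (n : ℝ)⁻¹ * u ^ (-(1 / 2 : ℝ)))) ^ 3 :=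
      pow_le_pow_left₀ (by positivity) (mul_le_mul_of_nonneg_left hmax (by positivity)) 3
    calc u * Real.exp (-u) * ∑ z : TorusSite D Λ, |G u z|
        ≤ u * Real.exp (-u) * (1260 * (48 : ℝ) ^ D * (((2 / 3 : ℝ) ^ (-(1 / 2 : ℝ))) * (n : ℝ)⁻¹ * u ^ (-(1 / 2 : ℝ)))) ^ 3 :=
          mul_le_mul_of_nonneg_left (hsum.trans hcube) (mul_pos hu (Real.exp_pos _)).le
      _ = K * ((u * (u ^ (-(1 / 2 : ℝ))) ^ 3) * Real.exp (-u)) := by rw [hK]; ring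
      _ = K * (u ^ (-(1 / 2 : ℝ)) * Real.exp (-u)) := by rw [mul_rpow_neg_half_cube hu]
  -- assemble
  have hmaj : IntegrableOn (fun u : ℝ => K * (u ^ (-(1 / 2 : ℝ)) * Real.exp (-u))) (Ioi 0) := integrableOn_rpow_neg_half_mul_exp_neg.const_mul K
  calc ∑ z : TorusSite D Λ, |((∫ u in Ioi (0 : ℝ), u * Real.exp (-u) * P u (z - Pi.single μ' 1 + Pi.single ν 1 + Pi.single μ 1))
          - (∫ u in Ioi (0 : ℝ), u * Real.exp (-u) * P u (z - Pi.single μ' 1 + Pi.single ν 1))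
          - (∫ u in Ioi (0 : ℝ), u * Real.exp (-u) * P u (z - Pi.single μ' 1 + Pi.single μ 1))
          + (∫ u in Ioi (0 : ℝ), u * Real.exp (-u) * P u (z - Pi.single μ' 1)))
        - ((∫ u in Ioi (0 : ℝ), u * Real.exp (-u) * P u (z + Pi.single ν 1 + Pi.single μ 1))
          - (∫ u in Ioi (0 : ℝ), u * Real.exp (-u) * P u (z + Pi.single ν 1))
          - (∫ u in Ioi (0 : ℝ), u * Real.exp (-u) * P u (z + Pi.single μ 1))
          + (∫ u in Ioi (0 : ℝ), u * Real.exp (-u) * P u z))|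
      = ∑ z : TorusSite D Λ, |∫ u in Ioi (0 : ℝ), F z u| := Finset.sum_congr rfl fun z _ => by rw [hcomb z]
    _ ≤ ∑ z : TorusSite D Λ, ∫ u in Ioi (0 : ℝ), |F z u| := Finset.sum_le_sum fun z _ => abs_integral_le_integral_abs
    _ = ∫ u in Ioi (0 : ℝ), ∑ z : TorusSite D Λ, |F z u| := (integral_finsetSum _ fun z _ => (hFint z).abs).symm
    _ ≤ ∫ u in Ioi (0 : ℝ), K * (u ^ (-(1 / 2 : ℝ)) * Real.exp (-u)) :=
        setIntegral_mono_on (integrable_finsetSum _ fun z _ => (hFint z).abs) hmaj measurableSet_Ioi fun u hu => hpt u hu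
    _ = K * Real.Gamma (1 / 2) := by rw [integral_const_mul, integral_rpow_neg_half_mul_exp_neg]
    _ = (1260 * (48 : ℝ) ^ D) ^ 3 * ((2 / 3 : ℝ) ^ (-(1 / 2 : ℝ))) ^ 3 * Real.Gamma (1 / 2) * ((n : ℝ)⁻¹) ^ 3 := by rw [hK]; ring

end Core

end Summit.QuantumFields.BalabanUV.Beta.FP.FreeBiResolventRowDiffCore

end
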